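import Literature.AnabelianGeometry.SemiGraphs.LocalizationDescent

/-!
# [SemiAnbd] Def 4.1 (iv) — merge step M4 part 3f: the induced morphisms are functorial (composites)

Mochizuki, *Semi-graphs of anabelioids*, Publ. RIMS **42** (2006), §4 Def 4.1 (iv) p.51 ("the
induced morphisms `ℋ[c] → ℋ'[c']`"), §2 Rmk 2.4.2 p.26 (the 1-category of semi-graphs of
anabelioids up to 2-isomorphism) (kurims `paper:url-f33ace170ff4`).
[cite: MochizukiSemiAnbd2006, Def 4.1 (iv), p. 51]

CONSTRUCTION ONLY (L3 bridge toward `SemiAnbdVocab.ofReal`, container laws `locMapV_comp` /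
`locMapE_comp` of `InterfaceVocab.lean` at the real vocabulary), additive over
`LocalizationDescent.lean`:

* `HomOver.Iso2.reflect` — post-composition with the natural 1-morphism `ℋ_ι → ℋ` of a pull-back
  (`inducedAlongHomOver`, identity constituent functors) REFLECTS 2-isomorphisms: a 2-cell between
  `α ∘→ (ℋ_ι → ℋ)` and `β ∘→ (ℋ_ι → ℋ)` restricts (by unitors) to a 2-cell between `α` and `β`;
* `HomOver.homMk_inducedAlongSquare_comp_inducedAlongSquare` — in the 1-category `SgAQuot`, the
  1-morphism induced over a pasted square by a composite `φ ∘→ ψ` is the composite of the induced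
  1-morphisms (both composites with `𝒦_{ι₃} → 𝒦` agree by `homMk_inducedAlongSquare_comp`, then
  reflect);
* instances = the container laws at the real localizations: `SgAQuot.Hom.atVertexMap_comp`,
  `SgAQuot.Hom.atEdgeMap_comp` (`(F ≫ G)[v] = F[v] ≫ G[F v]`).

Nothing printed is asserted.
-/

namespace Literature.AnabelianGeometry.SemiGraphs

open CategoryTheory Literature.AnabelianGeometry.Anabelioids

universe v₁ u₁ u

namespace SemiGraphOfAnabelioids

/-! ### Post-composition with `ℋ_ι → ℋ` reflects 2-isomorphisms -/

section Reflect

variable {𝒳 ℋ : SemiGraphOfAnabelioids.{v₁, u₁, u}} {H : SemiGraph.{u}} {ι : H ⟶ ℋ.graph}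
  {κ : 𝒳.graph ⟶ H} {α β : HomOver 𝒳 (ℋ.inducedAlong ι) κ}
  (σ : HomOver.Iso2 (α.comp (ℋ.inducedAlongHomOver ι)) (β.comp (ℋ.inducedAlongHomOver ι)))

/-- Vertex components of the reflected 2-cell: those of `σ`, conjugated by unitors (the vertex
components of `ℋ_ι → ℋ` are identity functors). [cite: MochizukiSemiAnbd2006, Rmk 2.4.2, p. 26] -/
noncomputable def HomOver.Iso2.reflectV (w : 𝒳.graph.Vertex) :
    (α.φV w).pullback ≅ (β.φV w).pullback :=
  (α.φV w).pullback.leftUnitor.symm ≪≫ σ.isoV w ≪≫ (β.φV w).pullback.leftUnitor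

/-- Edge components of the reflected 2-cell: those of `σ` at the canonical presentation of the
image edge (where the edge component of `ℋ_ι → ℋ` is the identity), conjugated by unitors, read at an
arbitrary presentation by transport. [cite: MochizukiSemiAnbd2006, Rmk 2.4.2, p. 26] -/
noncomputable def HomOver.Iso2.reflectE (e : 𝒳.graph.Edge) (e' : H.Edge) (h : κ.edgeMap e = e') :
    (α.φE e e' h).pullback ≅ (β.φE e e' h).pullback := by
  subst h
  exact (α.φE e _ rfl).pullback.leftUnitor.symm ≪≫ σ.isoE e (ι.edgeMap (κ.edgeMap e)) rfl ≪≫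
    (β.φE e _ rfl).pullback.leftUnitor

/-- Coherence of the reflected 2-cell along an abutting branch, over an ARBITRARY presentation of
the image edges (`e₁`, `e₂`), the branch morphism of `ℋ` (`Q`) and the 2-cells `φ_b` of `α`, `β`
(`α₀`, `β₀`): after `subst` the bridge `compEIso` and all transports are identities, and the
coherence of `σ` for the composites is literally the coherence sought.
[cite: MochizukiSemiAnbd2006, Rmk 2.4.2, p. 26] -/
theorem HomOver.Iso2.reflect_coh_aux {e : 𝒳.graph.Edge} {v : 𝒳.graph.Vertex}
    (R : Anabelioids.Hom (𝒳.E e) (𝒳.V v)) (e₁ : H.Edge) (h₁ : κ.edgeMap e = e₁)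
    (e₂ : ℋ.graph.Edge) (t : ι.edgeMap e₁ = e₂)
    (Q : Anabelioids.Hom (ℋ.E e₂) (ℋ.V (ι.vertexMap (κ.vertexMap v))))
    (α₀ : (α.φV v).pullback ⋙ R.pullback ≅
      ((ℋ.idE (ι.edgeMap e₁) e₂ t).comp Q).pullback ⋙ (α.φE e e₁ h₁).pullback)
    (β₀ : (β.φV v).pullback ⋙ R.pullback ≅
      ((ℋ.idE (ι.edgeMap e₁) e₂ t).comp Q).pullback ⋙ (β.φE e e₁ h₁).pullback)
    (hσ : α.compCell (ℋ.inducedAlongHomOver ι) R e₁ h₁ ((ℋ.idE (ι.edgeMap e₁) e₂ t).comp Q) e₂ t Q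
        α₀ (Q.pullback ⋙ (ℋ.idE (ι.edgeMap e₁) e₂ t).pullback).leftUnitor ≪≫
        Functor.isoWhiskerLeft Q.pullback (σ.isoE e e₂ (by subst h₁; exact t)) =
      Functor.isoWhiskerRight (σ.isoV v) R.pullback ≪≫
        β.compCell (ℋ.inducedAlongHomOver ι) R e₁ h₁ ((ℋ.idE (ι.edgeMap e₁) e₂ t).comp Q) e₂ t Q
          β₀ (Q.pullback ⋙ (ℋ.idE (ι.edgeMap e₁) e₂ t).pullback).leftUnitor) :
    α₀ ≪≫ Functor.isoWhiskerLeft ((ℋ.idE (ι.edgeMap e₁) e₂ t).comp Q).pullback (σ.reflectE e e₁ h₁) =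
      Functor.isoWhiskerRight (σ.reflectV v) R.pullback ≪≫ β₀ := by
  subst h₁; subst t
  ext X
  have hX := NatTrans.congr_app (congrArg Iso.hom hσ) X
  simp only [Iso.trans_hom, NatTrans.comp_app, Functor.isoWhiskerLeft_hom, Functor.whiskerLeft_app,
    Functor.isoWhiskerRight_hom, Functor.whiskerRight_app, HomOver.compCell_hom_app,
    HomOver.compEIso_rfl, Iso.refl_hom, NatTrans.id_app, Functor.leftUnitor_hom_app] at hX
  simp only [Iso.trans_hom, NatTrans.comp_app, Functor.isoWhiskerLeft_hom, Functor.whiskerLeft_app,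
    Functor.isoWhiskerRight_hom, Functor.whiskerRight_app, HomOver.Iso2.reflectE,
    HomOver.Iso2.reflectV, Iso.symm_hom, Functor.leftUnitor_hom_app, Functor.leftUnitor_inv_app]
  repeat (first
    | erw [CategoryTheory.Functor.map_id] at hX
    | erw [Category.id_comp] at hX
    | erw [Category.comp_id] at hX)
  repeat (first
    | erw [Category.id_comp]
    | erw [Category.comp_id])
  exact hX

/-- **Post-composition with `ℋ_ι → ℋ` reflects 2-isomorphisms**: a 2-cell between
`α ∘→ (ℋ_ι → ℋ)` and `β ∘→ (ℋ_ι → ℋ)` (1-morphisms `α, β : 𝒳 → ℋ_ι` over the same `κ`) yields a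
2-cell between `α` and `β` (Rmk 2.4.2: the natural 1-morphism of a pull-back has identity
constituent functors). [cite: MochizukiSemiAnbd2006, Rmk 2.4.2, p. 26] -/
noncomputable def HomOver.Iso2.reflect : HomOver.Iso2 α β where
  isoV w := σ.reflectV w
  isoE e e' h := σ.reflectE e e' h
  coh c w hc :=
    σ.reflect_coh_aux (𝒳.pull c w hc) (H.edgeOf (κ.branchMap c)) (κ.edgeOf_branchMap c).symm
      (ℋ.graph.edgeOf (ι.branchMap (κ.branchMap c))) (ι.edgeOf_branchMap (κ.branchMap c)).symm
      (ℋ.pull (ι.branchMap (κ.branchMap c)) (ι.vertexMap (κ.vertexMap w))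
        (ι.abuts_branchMap _ _ (κ.abuts_branchMap c w hc)))
      (α.φB c w hc) (β.φB c w hc) (σ.coh c w hc)

/-- Hence: if `α ∘→ (ℋ_ι → ℋ)` and `β ∘→ (ℋ_ι → ℋ)` define the same arrow of the 1-category
`SgAQuot`, so do `α` and `β`. [cite: MochizukiSemiAnbd2006, Rmk 2.4.2, p. 26] -/
theorem HomOver.homMk_eq_of_comp_inducedAlongHomOver (α β : HomOver 𝒳 (ℋ.inducedAlong ι) κ)
    (h : (SgAQuot.homMk (α.comp (ℋ.inducedAlongHomOver ι)) : SgAQuot.mk 𝒳 ⟶ SgAQuot.mk ℋ) =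
      SgAQuot.homMk (β.comp (ℋ.inducedAlongHomOver ι))) :
    (SgAQuot.homMk α : SgAQuot.mk 𝒳 ⟶ SgAQuot.mk (ℋ.inducedAlong ι)) = SgAQuot.homMk β := by
  obtain ⟨σ⟩ := (SgAQuot.homMk_eq_homMk_iff _ _).mp h
  exact (SgAQuot.homMk_eq_homMk_iff _ _).mpr ⟨σ.reflect⟩

end Reflect

/-! ### Functoriality of the induced 1-morphisms under composition -/

section Comp

variable {𝒢 ℋ 𝒦 : SemiGraphOfAnabelioids.{v₁, u₁, u}} {f : 𝒢.graph ⟶ ℋ.graph}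
  {g : ℋ.graph ⟶ 𝒦.graph} {H₁ H₂ H₃ : SemiGraph.{u}}

/-- Pasting two commutative squares of semi-graphs. [cite: MochizukiSemiAnbd2006, Def 4.1 (iv), p. 51] -/
theorem square_paste {ι₁ : H₁ ⟶ 𝒢.graph} {ι₂ : H₂ ⟶ ℋ.graph} {ι₃ : H₃ ⟶ 𝒦.graph} {κ₁ : H₁ ⟶ H₂}
    {κ₂ : H₂ ⟶ H₃} (r₁ : ι₁ ≫ f = κ₁ ≫ ι₂) (r₂ : ι₂ ≫ g = κ₂ ≫ ι₃) :
    ι₁ ≫ (f ≫ g) = (κ₁ ≫ κ₂) ≫ ι₃ := by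
  rw [← Category.assoc, r₁, Category.assoc, r₂, Category.assoc]

/-- **Functoriality of Def 4.1 (iv) under composition**, in the 1-category `SgAQuot`: the
1-morphism `𝒢_{ι₁} → 𝒦_{ι₃}` induced by `φ ∘→ ψ` over the pasted square is the composite of the
1-morphism `𝒢_{ι₁} → ℋ_{ι₂}` induced by `φ` and the 1-morphism `ℋ_{ι₂} → 𝒦_{ι₃}` induced by `ψ`.
[cite: MochizukiSemiAnbd2006, Def 4.1 (iv), p. 51] -/
theorem HomOver.homMk_inducedAlongSquare_comp_inducedAlongSquare (φ : HomOver 𝒢 ℋ f)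
    (ψ : HomOver ℋ 𝒦 g) (ι₁ : H₁ ⟶ 𝒢.graph) (ι₂ : H₂ ⟶ ℋ.graph) (ι₃ : H₃ ⟶ 𝒦.graph)
    (κ₁ : H₁ ⟶ H₂) (κ₂ : H₂ ⟶ H₃) (r₁ : ι₁ ≫ f = κ₁ ≫ ι₂) (r₂ : ι₂ ≫ g = κ₂ ≫ ι₃) :
    (SgAQuot.homMk ((φ.comp ψ).inducedAlongSquare ι₁ ι₃ (κ₁ ≫ κ₂) (square_paste r₁ r₂)) :
        SgAQuot.mk (𝒢.inducedAlong ι₁) ⟶ SgAQuot.mk (𝒦.inducedAlong ι₃)) =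
      (SgAQuot.homMk (φ.inducedAlongSquare ι₁ ι₂ κ₁ r₁) :
          SgAQuot.mk (𝒢.inducedAlong ι₁) ⟶ SgAQuot.mk (ℋ.inducedAlong ι₂)) ≫
        (SgAQuot.homMk (ψ.inducedAlongSquare ι₂ ι₃ κ₂ r₂) :
          SgAQuot.mk (ℋ.inducedAlong ι₂) ⟶ SgAQuot.mk (𝒦.inducedAlong ι₃)) := by
  rw [SgAQuot.homMk_comp_homMk]
  refine HomOver.homMk_eq_of_comp_inducedAlongHomOver (ℋ := 𝒦) (ι := ι₃)
    ((φ.comp ψ).inducedAlongSquare ι₁ ι₃ (κ₁ ≫ κ₂) (square_paste r₁ r₂))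
    ((φ.inducedAlongSquare ι₁ ι₂ κ₁ r₁).comp (ψ.inducedAlongSquare ι₂ ι₃ κ₂ r₂)) ?_
  calc (SgAQuot.homMk (((φ.comp ψ).inducedAlongSquare ι₁ ι₃ (κ₁ ≫ κ₂) (square_paste r₁ r₂)).comp
          (𝒦.inducedAlongHomOver ι₃)) : SgAQuot.mk (𝒢.inducedAlong ι₁) ⟶ SgAQuot.mk 𝒦)
      = (SgAQuot.homMk (𝒢.inducedAlongHomOver ι₁) :
            SgAQuot.mk (𝒢.inducedAlong ι₁) ⟶ SgAQuot.mk 𝒢) ≫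
          (SgAQuot.homMk (φ.comp ψ) : SgAQuot.mk 𝒢 ⟶ SgAQuot.mk 𝒦) :=
        HomOver.homMk_inducedAlongSquare_comp (φ.comp ψ) ι₁ ι₃ (κ₁ ≫ κ₂) (square_paste r₁ r₂)
    _ = ((SgAQuot.homMk (𝒢.inducedAlongHomOver ι₁) :
            SgAQuot.mk (𝒢.inducedAlong ι₁) ⟶ SgAQuot.mk 𝒢) ≫
          (SgAQuot.homMk φ : SgAQuot.mk 𝒢 ⟶ SgAQuot.mk ℋ)) ≫
          (SgAQuot.homMk ψ : SgAQuot.mk ℋ ⟶ SgAQuot.mk 𝒦) := by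
        rw [Category.assoc, SgAQuot.homMk_comp_homMk φ ψ]
    _ = ((SgAQuot.homMk (φ.inducedAlongSquare ι₁ ι₂ κ₁ r₁) :
            SgAQuot.mk (𝒢.inducedAlong ι₁) ⟶ SgAQuot.mk (ℋ.inducedAlong ι₂)) ≫
          (SgAQuot.homMk (ℋ.inducedAlongHomOver ι₂) :
            SgAQuot.mk (ℋ.inducedAlong ι₂) ⟶ SgAQuot.mk ℋ)) ≫
          (SgAQuot.homMk ψ : SgAQuot.mk ℋ ⟶ SgAQuot.mk 𝒦) := by
        rw [SgAQuot.homMk_comp_homMk (𝒢.inducedAlongHomOver ι₁) φ,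
          SgAQuot.homMk_comp_homMk (φ.inducedAlongSquare ι₁ ι₂ κ₁ r₁) (ℋ.inducedAlongHomOver ι₂),
          HomOver.homMk_inducedAlongSquare_comp φ ι₁ ι₂ κ₁ r₁]
    _ = (SgAQuot.homMk (φ.inducedAlongSquare ι₁ ι₂ κ₁ r₁) :
            SgAQuot.mk (𝒢.inducedAlong ι₁) ⟶ SgAQuot.mk (ℋ.inducedAlong ι₂)) ≫
          ((SgAQuot.homMk (ℋ.inducedAlongHomOver ι₂) :
              SgAQuot.mk (ℋ.inducedAlong ι₂) ⟶ SgAQuot.mk ℋ) ≫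
            (SgAQuot.homMk ψ : SgAQuot.mk ℋ ⟶ SgAQuot.mk 𝒦)) := Category.assoc _ _ _
    _ = (SgAQuot.homMk (φ.inducedAlongSquare ι₁ ι₂ κ₁ r₁) :
            SgAQuot.mk (𝒢.inducedAlong ι₁) ⟶ SgAQuot.mk (ℋ.inducedAlong ι₂)) ≫
          ((SgAQuot.homMk (ψ.inducedAlongSquare ι₂ ι₃ κ₂ r₂) :
              SgAQuot.mk (ℋ.inducedAlong ι₂) ⟶ SgAQuot.mk (𝒦.inducedAlong ι₃)) ≫
            (SgAQuot.homMk (𝒦.inducedAlongHomOver ι₃) :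
              SgAQuot.mk (𝒦.inducedAlong ι₃) ⟶ SgAQuot.mk 𝒦)) := by
        rw [SgAQuot.homMk_comp_homMk (ℋ.inducedAlongHomOver ι₂) ψ,
          SgAQuot.homMk_comp_homMk (ψ.inducedAlongSquare ι₂ ι₃ κ₂ r₂) (𝒦.inducedAlongHomOver ι₃),
          HomOver.homMk_inducedAlongSquare_comp ψ ι₂ ι₃ κ₂ r₂]
    _ = (SgAQuot.homMk (((φ.inducedAlongSquare ι₁ ι₂ κ₁ r₁).comp
            (ψ.inducedAlongSquare ι₂ ι₃ κ₂ r₂)).comp (𝒦.inducedAlongHomOver ι₃)) :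
          SgAQuot.mk (𝒢.inducedAlong ι₁) ⟶ SgAQuot.mk 𝒦) := by
        rw [← Category.assoc,
          SgAQuot.homMk_comp_homMk (φ.inducedAlongSquare ι₁ ι₂ κ₁ r₁) (ψ.inducedAlongSquare ι₂ ι₃ κ₂ r₂),
          SgAQuot.homMk_comp_homMk _ (𝒦.inducedAlongHomOver ι₃)]

end Comp

end SemiGraphOfAnabelioids

/-! ### Instances: the container laws `locMapV_comp`, `locMapE_comp` on arrows of the 1-category -/

namespace SgAQuot

open SemiGraphOfAnabelioids

variable {X Y Z : SgAQuot.{v₁, u₁, u}}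

/-- **Law `locMapV_comp`: `(F ≫ G)[v] = F[v] ≫ G[F v]`** — the morphism `X[v] → Z[(F ≫ G) v]`
induced by a composite is the composite of the induced morphisms (Def 4.1 (iv), functoriality of
localization at vertices). [cite: MochizukiSemiAnbd2006, Def 4.1 (iv), p. 51] -/
theorem Hom.atVertexMap_comp (F : X ⟶ Y) (G : Y ⟶ Z) (v : X.toSgA.graph.Vertex) :
    Hom.atVertexMap (F ≫ G) v = Hom.atVertexMap F v ≫ Hom.atVertexMap G (F.base.vertexMap v) := by
  obtain ⟨f, a⟩ := F
  obtain ⟨g, b⟩ := G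
  induction a using Quotient.ind with
  | _ φ =>
    induction b using Quotient.ind with
    | _ ψ =>
      exact HomOver.homMk_inducedAlongSquare_comp_inducedAlongSquare φ ψ
        (X.toSgA.graph.atVertexHom v) (Y.toSgA.graph.atVertexHom (f.vertexMap v))
        (Z.toSgA.graph.atVertexHom (g.vertexMap (f.vertexMap v))) (SemiGraph.atVertexMap f v)
        (SemiGraph.atVertexMap g (f.vertexMap v))
        (SemiGraph.atVertexMap_comp_atVertexHom f v).symm
        (SemiGraph.atVertexMap_comp_atVertexHom g (f.vertexMap v)).symm

/-- **Law `locMapE_comp`: `(F ≫ G)[e] = F[e] ≫ G[F e]`** — functoriality of localization at edges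
under composition (Def 4.1 (iv)). [cite: MochizukiSemiAnbd2006, Def 4.1 (iv), p. 51] -/
theorem Hom.atEdgeMap_comp (F : X ⟶ Y) (G : Y ⟶ Z) (e : X.toSgA.graph.Edge) :
    Hom.atEdgeMap (F ≫ G) e = Hom.atEdgeMap F e ≫ Hom.atEdgeMap G (F.base.edgeMap e) := by
  obtain ⟨f, a⟩ := F
  obtain ⟨g, b⟩ := G
  induction a using Quotient.ind with
  | _ φ =>
    induction b using Quotient.ind with
    | _ ψ =>
      exact HomOver.homMk_inducedAlongSquare_comp_inducedAlongSquare φ ψ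
        (X.toSgA.graph.atEdgeHom e) (Y.toSgA.graph.atEdgeHom (f.edgeMap e))
        (Z.toSgA.graph.atEdgeHom (g.edgeMap (f.edgeMap e))) (SemiGraph.atEdgeMap f e)
        (SemiGraph.atEdgeMap g (f.edgeMap e))
        (SemiGraph.atEdgeMap_comp_atEdgeHom f e).symm
        (SemiGraph.atEdgeMap_comp_atEdgeHom g (f.edgeMap e)).symm

end SgAQuot

end Literature.AnabelianGeometry.SemiGraphs
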